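/-
COR-CM (cell pub-hodgecm2, stage 2 of the Hodge ladder) — Δ2 BRIDGE, ORIENTATION AUDIT, T2 × T5 — EDITION 1's DISPLAYED ROWS (twin of `OrientationT2CitesVacuityEd2`)
(wb-8, T2 pair; answers the cell lead's question cm2 INBOX l.13962 (3)).  THEOREMS ONLY + edition 1's own `local notation`s re-declared VERBATIM (needed to
quote its binder types byte-for-byte; no `def`, no instance, no section `variable`, no named fact, no `sorry`); nothing landed is edited or restated.
FRAMING: HC_CM is NOT proved; «Δ2 BRIDGE CLOSED» is NOT claimed; `hLiu′` = READING r8; AUDIT module (evidence either way).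
-/
import Summits.HodgeConjecture.CorCM.D2Bridge.OrientationT2CitesVacuityEd2
import HarnessLib

/-!
# Δ2 bridge, orientation audit T2 × T5 — edition 1's seven displayed rows are jointly CONTRADICTORY

Edition 1 ✔ p372014 `PortJoin.hc_cm_of_printed_citations` (`CorCM/PortJoin/ClosedPrinted.lean` :259) displays sixteen binders written with ten
`local notation`s (:57–:97).  This file re-declares those notations VERBATIM and quotes SEVEN of edition 1's `Prop` rows BYTE-FOR-BYTE — `h` (:259),
`h21` (:266), `hLiu'` ∕ `h411` ∕ `h413` ∕ `hμsep` ∕ `hD1'` (:302–:336) — and derives `False` from them: the notations unfold (syntactically) to edition 2's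
inlined texts, so ✔∕pending `false_of_edition2_rows` (wb-8, `OrientationT2CitesVacuityEd2`) applies to edition 1's binders by `exact`.

* **`false_of_edition1_rows`** — `h ∧ h21 ∧ hLiu' ∧ h411 ∧ h413 ∧ hμsep ∧ hD1'` (edition 1's types VERBATIM, in its own notation) ⟹ `False`.

READING (audit).  As for edition 2: the END edition 1 derives `HC_CM` from a displayed family of which this 7-subset is contradictory as typed.  Which row
is false IN PRINT is NOT decided here; HC_CM is NOT proved; «Δ2 BRIDGE CLOSED» is NOT claimed.
-/

set_option autoImplicit false

noncomputable section

open scoped TensorProduct Matrix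

namespace Summit.HodgeConjecture.CorCM.D2Bridge

open NumberField NumberField.InfinitePlace
open HodgeCM.Model HodgeCM.Model.LiuIndex HodgeCM.Model.TowerCarrier
open HodgeCM.Literature.Theta.LiuAlbaneseModuleDatum.D2Bridge (HcmPieces)
open Summit.HodgeConjecture.CorCM.Model
open Literature.AlgebraicGeometry.Motives (CMType)
open Literature.AlgebraicGeometry.HodgeTheory Literature.NumberTheory.Automorphic.PicardCM
open Literature.AlgebraicGeometry.ShimuraVarieties.UnitaryCanonicalModel
open Literature.NumberTheory.ComplexMultiplication
open Literature.NumberTheory.Automorphic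
open Literature.NumberTheory.Automorphic.IdeleClassGroup (toHeckeCharacter isUnitary_toHeckeCharacter)
open Literature.NumberTheory.Automorphic.Liu2021 Literature.NumberTheory.Automorphic.Liu2021.AppendixC
open Literature.NumberTheory.Automorphic.Liu2021.AppendixC.RestOne
open Literature.NumberTheory.Automorphic.Liu2021.Def411WeilCarriers (lineOf locF Rep)
open Summit.HodgeConjecture.CorCM.Transposition.OmegaTransport (realUnit)
open HodgeCM.Model.ArchSideTerm (e₁)
open Literature.NumberTheory.GelbartRogawski1991 Literature.NumberTheory.GelbartRogawski1991.UnitaryDualPair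
open Literature.NumberTheory.GelbartRogawski1991.UnitaryDualPair.LocalSplitting (localMu norm_localMu continuous_localMu localMu_toLocalRing_eq_one_iff)
open Literature.RepresentationTheory Literature.RepresentationTheory.Liu2021
open Summit.HodgeConjecture.CorCM.Transposition


/-! ## Edition 1's `local notation`s, VERBATIM (`ClosedPrinted.lean` :57–:97) -/

set_option quotPrecheck false
/-- the PINNED DICTIONARY OF RECORD at `(V, ι₁, a₀)` over the five `_holds` rows (the `h418` binder's dictionary, ✔ `PortJoin/Closed.lean`). -/
local notation "𝔇⟦" V "," ι₁ "," a₀ "⟧" =>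
  liuDictionaryPin exists_isReal_hodgeModel_holds hodgePQ_independent_of_hodgeModel_holds BallQuotient.ballQuotientUniformised_holds
    (cmAbelianVarietyRealised_of_eigenbasis exists_isReal_hodgeModel_holds hodgePQ_independent_of_hodgeModel_holds
      cmAbelianVarietyEigenbasisRealised_holds)
    Literature.NumberTheory.Transcendental.arapura2012_cor_15_4_6_holds V (I V (repAt a₀) (muLiu ι₁ GramClass.rep))
    (line V (repAt a₀) (muLiu ι₁ GramClass.rep))
/-- the App-C standing datum of record `sec42DataOf h isoOf F ι₁ V Φ` ([Liu21, §4.2 ∕ App. C]) at the ported codes. -/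
local notation "ℭ⟦" h "," F "," ι₁ "," V "," Φ "⟧" =>
  sec42DataOf h isoOf ⟨HodgeCM.CMField.K F⟩ ι₁
    ⟨HodgeCM.HermSpace3.Hm V, HodgeCM.HermSpace3.isHermitian V, HodgeCM.HermSpace3.signature_ι₁ V, HodgeCM.HermSpace3.posDef_of_ne V⟩ Φ
/-- the TAIL OF THE REST OF RECORD at `μ` ([Liu21, Def. 4.5 (2), 4.16, Rem. 4.17]): `restTailOne id ι₁ hμ hw (ofPolDR …) (𝒯.rhoΩOne …)`. -/
local notation "𝔱⟦" h "," h6 "," F "," ι₁ "," V "," Φ "," μ "," hμ "," hw "⟧" =>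
  restTailOne (AlgHom.id ℚ _) ι₁ hμ hw (Def45.Carriers.ofPolDR μ (Def45.PolDR ι₁ hμ (Def45.RMuForm ι₁ hμ)))
    ((heckeTranslatesFamilyOf heckeTranslate_definedOver_holds h isoOf ⟨HodgeCM.CMField.K F⟩ ι₁
      ⟨HodgeCM.HermSpace3.Hm V, HodgeCM.HermSpace3.isHermitian V, HodgeCM.HermSpace3.signature_ι₁ V, HodgeCM.HermSpace3.posDef_of_ne V⟩ Φ
      h6).rhoΩOne (AlgHom.id ℚ _) ι₁ hμ hw (Def45.Carriers.ofPolDR μ (Def45.PolDR ι₁ hμ (Def45.RMuForm ι₁ hμ))))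
/-- the INDEX OF RECORD `LiuIndex.I V (repAt a₀) (muLiu ι₁ rep)` and its lines (port layer 69; the `h418` binder's enumeration). -/
local notation "𝕀⟦" V "," ι₁ "," a₀ "⟧" => I V (repAt a₀) (muLiu ι₁ GramClass.rep)
local notation "𝕃⟦" V "," ι₁ "," a₀ "⟧" => line V (repAt a₀) (muLiu ι₁ GramClass.rep)
/-- `ℙ i`: Liu's `τ′ ∈ Φ_μ` at the line (`PhiMuLine ι₁ (line i)`); `𝔾 i`: the GOOD lines = continuous pair splitting (else `block i = ⊥`). -/
local notation "ℙ⟦" V "," ι₁ "," a₀ "," i "⟧" => SplitLine.PhiMuLine ι₁ (line V (repAt a₀) (muLiu ι₁ GramClass.rep) i)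
local notation "𝔾⟦" V "," a₀ "," i "⟧" => Continuous (Subtype.val (Sigma.snd i) : SplittingAt V (repAt a₀ (Sigma.fst i)))
/-- the representative section of record at the index line `i` (re-points Def. 4.12's collection at the package's line `⟨u_{a_i}⟩`). -/
local notation "𝕣⟦" F "," a₀ "," i "⟧" =>
  Rep.update ↥(maximalRealSubfield (HodgeCM.CMField.K F)) (imagUnitSq (HodgeCM.CMField.K F))
    (Rep.ofLineOf ↥(maximalRealSubfield (HodgeCM.CMField.K F)) (imagUnitSq (HodgeCM.CMField.K F)))
    (locF ↥(maximalRealSubfield (HodgeCM.CMField.K F)) (imagUnitSq (HodgeCM.CMField.K F))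
      (realUnit ⟨HodgeCM.CMField.K F⟩ (repAt a₀ (Sigma.fst i)).1 (repAt a₀ (Sigma.fst i)).2.1 (repAt a₀ (Sigma.fst i)).2.2))
    (realUnit ⟨HodgeCM.CMField.K F⟩ (repAt a₀ (Sigma.fst i)).1 (repAt a₀ (Sigma.fst i)).2.1 (repAt a₀ (Sigma.fst i)).2.2) rfl
/-- the μ-UNIFORM WEIL CARRIERS OF RECORD at the index line `i` (own-htheta ✔ `Model.uniformOmegaRep` at `δ′ = (2δ_F)⁻¹`, section 𝕣). -/
local notation "𝕌⟦" h "," F "," ι₁ "," V "," Φ "," a₀ "," i "⟧" =>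
  uniformOmegaRep h ⟨HodgeCM.CMField.K F⟩ ι₁
    ⟨HodgeCM.HermSpace3.Hm V, HodgeCM.HermSpace3.isHermitian V, HodgeCM.HermSpace3.signature_ι₁ V, HodgeCM.HermSpace3.posDef_of_ne V⟩ Φ
    e₁ (frameD V) (frameD_real V) (frameD_ne V) (ιVE V) (2 * imagUnit (HodgeCM.CMField.K F))⁻¹ (fun _ _ => 𝕣⟦F, a₀, i⟧)
/-- LIU'S OWN δ′ REST OF RECORD at `(i, μ)`: F4's `restOfCharDeltaPrime` (δ′ = (2δ_F)⁻¹ EXACT) at `(e₁, frameD V, ιVE V, 𝕣 i)`; `= (𝕌 i).rest (restTailOne …)` (`rfl`). -/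
local notation "𝔯⟦" h "," h6 "," F "," ι₁ "," V "," Φ "," a₀ "," i "," μ "," hμ "," hw "⟧" =>
  restOfCharDeltaPrime h ⟨HodgeCM.CMField.K F⟩ h6 ι₁
    ⟨HodgeCM.HermSpace3.Hm V, HodgeCM.HermSpace3.isHermitian V, HodgeCM.HermSpace3.signature_ι₁ V, HodgeCM.HermSpace3.posDef_of_ne V⟩ Φ
    e₁ (frameD V) (frameD_real V) (frameD_ne V) (ιVE V) 𝕣⟦F, a₀, i⟧ μ hμ hw


/-! ## Edition 1's displayed rows are jointly CONTRADICTORY -/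

set_option synthInstance.maxHeartbeats 400000 in
set_option maxHeartbeats 8000000 in
/-- **EDITION 1's seven displayed `Prop` rows `h, h21, hLiu', h411, h413, hμsep, hD1'` — types BYTE-IDENTICAL to ✔ p372014
`PortJoin.hc_cm_of_printed_citations` :259, :266, :302–:336 (in edition 1's own notation, re-declared above) — DERIVE `False`**: the notations unfold to
edition 2's inlined row texts, so `false_of_edition2_rows` applies verbatim.  HC_CM is NOT proved.
[cite: Liu2021, Thm. 4.18 (FJcycle.tex l. 2232–2245); Prop. 4.13 (l. 2113–2119); Def. 4.11; App. D Lem. D.1 (1),(3)] [cite: Shimura1998, §21.4 Thm. 21.4] -/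
theorem false_of_edition1_rows
    (h : exists_recordSystem) (h21 : shimura1998_thm21_4_casselman)
    -- edition 1's Δ2-side citation rows, `ClosedPrinted.lean` :302–:336 VERBATIM
    (hLiu' : ∀ (F : HodgeCM.CMField) [IsGalois ℚ F] (h6 : 6 ≤ Module.finrank ℚ F) {ι₁ : F →+* ℂ} (V : HodgeCM.HermSpace3 F ι₁) (a₀ : RealScalar F)
      (Φ : CMType F) (hΦ : ι₁ ∈ Φ.1) (i : 𝕀⟦V, ι₁, a₀⟧) (μ : Literature.NumberTheory.Automorphic.IdeleClassGroup (F : Type) →ₜ* Circle)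
      (hμ : IdeleClassGroup.IsConjugateSymplectic (F : Type) μ) (hw : IdeleClassGroup.HasWeight (F : Type) μ 1),
      Thm418AsPrinted (toThm418Data _ 𝔯⟦h, h6, F, ι₁, V, Φ, a₀, i, μ, hμ, hw⟧))
    (h411 : ∀ (F : HodgeCM.CMField) [IsGalois ℚ F] (h6 : 6 ≤ Module.finrank ℚ F) {ι₁ : F →+* ℂ} (V : HodgeCM.HermSpace3 F ι₁) (a₀ : RealScalar F)
      (Φ : CMType F) (hΦ : ι₁ ∈ Φ.1) (i : 𝕀⟦V, ι₁, a₀⟧) (μ : Literature.NumberTheory.Automorphic.IdeleClassGroup (F : Type) →ₜ* Circle)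
      (hμ : IdeleClassGroup.IsConjugateSymplectic (F : Type) μ) (hw : IdeleClassGroup.HasWeight (F : Type) μ 1),
      Def411AsPrinted (toThm418Data _ 𝔯⟦h, h6, F, ι₁, V, Φ, a₀, i, μ, hμ, hw⟧))
    (h413 : ∀ (F : HodgeCM.CMField) [IsGalois ℚ F] (h6 : 6 ≤ Module.finrank ℚ F) {ι₁ : F →+* ℂ} (V : HodgeCM.HermSpace3 F ι₁) (a₀ : RealScalar F)
      (Φ : CMType F) (hΦ : ι₁ ∈ Φ.1) (i : 𝕀⟦V, ι₁, a₀⟧), Prop413AsPrinted ((𝕌⟦h, F, ι₁, V, Φ, a₀, i⟧).prop413Data (𝔇⟦V, ι₁, a₀⟧).H))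
    (hμsep : ∀ (F : HodgeCM.CMField) [IsGalois ℚ F] (h6 : 6 ≤ Module.finrank ℚ F) {ι₁ : F →+* ℂ} (V : HodgeCM.HermSpace3 F ι₁) (a₀ : RealScalar F)
      (Φ : CMType F) (hΦ : ι₁ ∈ Φ.1) (i : 𝕀⟦V, ι₁, a₀⟧) (s t : ((𝕌⟦h, F, ι₁, V, Φ, a₀, i⟧).prop413Data (𝔇⟦V, ι₁, a₀⟧).H).AdmTriple), Nontrivial (((𝕌⟦h, F, ι₁, V, Φ, a₀, i⟧).prop413Data (𝔇⟦V, ι₁, a₀⟧).H).omegaAt s) →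
      (∃ f : ((𝕌⟦h, F, ι₁, V, Φ, a₀, i⟧).prop413Data (𝔇⟦V, ι₁, a₀⟧).H).omegaAt s ≃ₗ[ℂ] ((𝕌⟦h, F, ι₁, V, Φ, a₀, i⟧).prop413Data (𝔇⟦V, ι₁, a₀⟧).H).omegaAt t,
        ∀ (g : ↥V.adelicFin) (v : ((𝕌⟦h, F, ι₁, V, Φ, a₀, i⟧).prop413Data (𝔇⟦V, ι₁, a₀⟧).H).omegaAt s), f (((𝕌⟦h, F, ι₁, V, Φ, a₀, i⟧).prop413Data (𝔇⟦V, ι₁, a₀⟧).H).rhoAt s g v) = ((𝕌⟦h, F, ι₁, V, Φ, a₀, i⟧).prop413Data (𝔇⟦V, ι₁, a₀⟧).H).rhoAt t g (f v)) → s.1.μ = t.1.μ)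
    (hD1' : ∀ (F : HodgeCM.CMField) [IsGalois ℚ F] (h6 : 6 ≤ Module.finrank ℚ F) {ι₁ : F →+* ℂ} (V : HodgeCM.HermSpace3 F ι₁) (a₀ : RealScalar F)
      (Φ : CMType F) (hΦ : ι₁ ∈ Φ.1) (i : 𝕀⟦V, ι₁, a₀⟧) (μ : Literature.NumberTheory.Automorphic.IdeleClassGroup (F : Type) →ₜ* Circle)
      (hμ : IdeleClassGroup.IsConjugateSymplectic (F : Type) μ) (hw : IdeleClassGroup.HasWeight (F : Type) μ 1) (hΦμ : IdeleClassGroup.HasCMType (F : Type) μ (𝕃⟦V, ι₁, a₀⟧ i).lineType)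
      (j : (toThm418Data _ 𝔯⟦h, h6, F, ι₁, V, Φ, a₀, i, μ, hμ, hw⟧).AdmIndex) (v : IsDedekindDomain.HeightOneSpectrum (𝓞 ↥(maximalRealSubfield (F : Type)))),
      LemD1_1AsPrinted
        (Def411WeilCarriers.localLemD1Data ↥(maximalRealSubfield (F : Type)) (F : Type) (IsCMField.complexConj (F : Type)) 3 e₁
          (Matrix.diagonal (frameD V)) (complexConj_imagUnit (F : Type)) (imagUnit_ne_zero (F : Type)) (imagUnit_mul_self (F : Type))
          (realDiagonal_isSymm (F : Type) (frameD V) (frameD_real V)) (isUnit_det_realDiagonal (F : Type) (frameD V) (frameD_real V) (frameD_ne V))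
          (realDiagonal_map (F : Type) (frameD V) (frameD_real V)).symm ((𝕣⟦F, a₀, i⟧).toFun j.1.1)
          (OmegaChiSplitting.chiLocalSplittingsD ⟨HodgeCM.CMField.K F⟩ e₁ (frameD V) (frameD_real V) (frameD_ne V) (toHeckeCharacter (F : Type) μ)
            ((isOscillatorChar_toHeckeCharacter_iff μ).mpr hμ) ((𝕣⟦F, a₀, i⟧).toFun j.1.1))
          (le_refl 3) (localMu (F : Type) (toHeckeCharacter (F : Type) μ))
          (fun v x => norm_localMu (F : Type) (toHeckeCharacter (F : Type) μ) v (isUnitary_toHeckeCharacter (F : Type) μ) x)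
          (continuous_localMu (F : Type) (toHeckeCharacter (F : Type) μ))
          (fun v t => localMu_toLocalRing_eq_one_iff (F : Type) (toHeckeCharacter (F : Type) μ) v ((isOscillatorChar_toHeckeCharacter_iff μ).mpr hμ) t)
          j.1.2.1
          (Def411WeilCarriers.norm_chi_eq_one ↥(maximalRealSubfield (F : Type)) (F : Type) (IsCMField.complexConj (F : Type))
            (Algebra.IsQuadraticExtension.finrank_eq_two ↥(maximalRealSubfield (F : Type)) (F : Type))
            (UnitaryGroup.algEquiv_ne_one_of_apply_eq_neg ↥(maximalRealSubfield (F : Type)) (F : Type) (IsCMField.complexConj (F : Type))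
              (complexConj_imagUnit (F : Type)) (imagUnit_ne_zero (F : Type))) j.1.2)
          j.1.2.2.1 v)) : False :=
  false_of_edition2_rows h h21 hLiu' h411 h413 hμsep hD1'

end Summit.HodgeConjecture.CorCM.D2Bridge

end
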